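import Summits.ResolutionOfSingularities.ResolutionOfSingularities.Theorems.EquisingularLiftEquisingularLiftNatPlaneCurveCharts
import HarnessLib

/-!
# [OURS · L1 W4.5(b) · EL♮(3) · NEST host kit, part 3c-b] EVERY PLANE CURVE IS UNOBSTRUCTED (model level):
# `DirStepUnobs ℙ²_k univ _ V₊(F) _` for every homogeneous `F` with a point off the curve and squarefree chart equations

Crux chain w45b (cell `res-hironaka`, LADDER-RESOLUTION rung L, slot W4.5(b)), child EL♮(3) = stmt-ResolutionOfSingularities-20148;
WIDTH TABLE D3 «NEST» (desk RULING R39 (i), D3-7 producer res-L1-w45b-nose-w1 ✓ `…NatDirStepUnobsOfCharts`, D3-8 conic res-L1-w45b-iso-w4,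
D3-10 / (U-plane) / (K-split) this seat ✓ `…NatDirStepUnobsHostChange` · `…NatFreshPlaneProj` · `…NatPlaneChartsAwayMk` · `…NatPlaneCurveTwistedSplit`).
res-L1-w45b-iso-w2 g2 (WIDTH seat D-0157 DOOR 1), `--supports stmt-ResolutionOfSingularities-20148 --as helper`.  OURS; NOT a statement of any
manuscript; AI-written, weaker than expert review.  No `sorry`; standard axioms; DEF-FREE.

WHAT — exactly the 6 theorems of this file (namespace `…Sections.PlaneCurveSplit`; `ℙ²_k = Proj k[X₀,X₁,X₂]`, charts `D₊(X₁)`, `D₊(X₂)` =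
the tree's `SmoothHypersurface.coordChartOpen k 1 / 2`, chart equations `SmoothHypersurface.chartEqn F i hF = F/Xᵢ^d`):
* `awayMap_chartEqn_one_eq`, `awayMap_chartEqn_one_eq_mk` (the transition `F/X₁^d = (X₂/X₁)^d · F/X₂^d` in `Γ(D₊(X₁X₂))`),
  `res_chartEqn_one_mem` (the restricted chart-1 equation lies in the curve's ideal on `D₊(X₁) ∩ D₊(X₂)`), `transition_sections` (the same
  transition read on sections), `twisted_splitting_sections` (✓ `planeCurve_twisted_split` of …NatPlaneCurveTwistedSplit read on sections:
  every section on the overlap splits as `(from chart 1) + (X₂/X₁)^d·(from chart 2) + (multiple of the equation)`);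
* **`dirStepUnobs_planeCurve`** — `DirStepUnobs ℙ²_k univ _ V₊(F) _` for EVERY field `k` and EVERY homogeneous `F` of degree `d ≥ 1` with unit
  `X₀^d`-coefficient whose chart equations `F/X₁^d`, `F/X₂^d` generate RADICAL ideals (⇔ `F` cuts out the reduced curve on both charts; e.g.
  `F` squarefree): the plane curve's embedded deformations are unobstructed, `Ȟ¹(C, 𝒩) = Ȟ¹(C, 𝒪_C(d)) = 0` — res-L1-w45b-nose-w1's producer
  `dirStepUnobs_univ_of_two_charts` (…NatDirStepUnobsOfCharts) fed with the chart data.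
IMPORTED, NOT HERE (part 3c-a, ✓ …NatPlaneCurveCharts): the chart plumbing `inf_chart_le`, `basicOpen_mul_le_inf_chart`, `isAffineOpen_inf_chart`,
`res₁_awayToSection`, `res₂_awayToSection`, `surjective_res_awayToSection₁₂`, and `chartEqn_eq_mk`, `eq_zero_of_chartEqn_mul_eq_zero`,
`isQuasiRegular_chartEqn`, `span_chartEqn_eq_ideal`, `X_one_notMem_or_X_two_notMem` (used below by name).

CUSTOMERS / DOORS.  With ✓ `dirStepUnobs_freshPlane_of_forall_model` (…NatFreshPlaneProj) and ✓ (H2) `dirStepUnobs_of_model_iso`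
(…NatDirStepUnobsHostChange): the NEST clause `DirStepUnobs G' E' _ Z _` of any centre that is a reduced plane curve in a fresh plane `E' ≅ ℙ²`
(S10's conic, lines, the (β) post-carrier curves), given the identification of `Z` with such a `V₊(F)`.  Degenerate checks (by type): `hu` is
load-bearing (without it the two charts need not cover the curve: `F = X₁X₂`); `hrad` is load-bearing (`F = X₀²·…`-type non-reduced equations do
not generate the REDUCED curve's ideal, which is what `DirStepUnobs`'s `redSub` reads); `hd : 0 < d` feeds `idealSheaf_ideal_coordChartOpen`.
HONEST SCOPE: model-level statement on `ℙ²_k`; counted 0; EL♮(3) is NOT proved; resolution in characteristic `p` is NOT proved here (dim 3 is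
Cossart–Piltant 2008/2009 in print).

References (index only): R. Hartshorne, *Algebraic Geometry* (1977), II Prop. 2.5, II Example 3.2.6, III Thm. 5.1 [cite: Hartshorne1977];
The Stacks Project, Tag 01ED [cite: StacksProject].
-/

set_option linter.dupNamespace false -- mandated namespace `Summit.<Summit>.<Problem>` of this single-conjunct summit

noncomputable section

-- `TopCat.Presheaf`/`Scheme.Modules` are not reducible (as in Mathlib's `AlgebraicGeometry/Modules`).
set_option backward.isDefEq.respectTransparency false

open CategoryTheory AlgebraicGeometry Opposite TopologicalSpace MvPolynomial HomogeneousLocalization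
open Literature.AlgebraicGeometry.Motives Literature.AlgebraicGeometry.Motives.ProjectiveSpace

attribute [local instance] MvPolynomial.gradedAlgebra ProjBaseChange.algebraBase

namespace Summit.ResolutionOfSingularities.ResolutionOfSingularities.Cruxes.EquisingularLiftNat.Sections

namespace PlaneCurveSplit

variable (k : Type) [Field k]

section Curve

variable {k} {d : ℕ} (F : MvPolynomial (Fin 3) k) (hF : F.IsHomogeneous d)

/-! ### The transition and the splitting, read on sections of `ℙ²_k` -/

/-- In `(k[X]_{(X₁X₂)})₀`: `F/X₁^d = (X₂/X₁)^d · F/X₂^d` (both are `F X₂^d … /(X₁X₂)^…`). [folklore] -/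
theorem awayMap_chartEqn_one_eq :
    awayMap (homogeneousSubmodule (Fin 3) k) (X_two_mem k) (rfl : (X 1 * X 2 : MvPolynomial (Fin 3) k) = X 1 * X 2)
        (SmoothHypersurface.chartEqn F 1 hF) =
      Away.mk _ (X_one_mul_X_two_mem k) 1 (X 2 * X 2) (X_two_sq_mem k) ^ d *
        awayMap (homogeneousSubmodule (Fin 3) k) (X_one_mem k) (mul_comm (X 1 : MvPolynomial (Fin 3) k) (X 2))
          (SmoothHypersurface.chartEqn F 2 hF) := by
  rw [chartEqn_eq_mk F hF 1, chartEqn_eq_mk F hF 2, awayMap_mk, awayMap_mk, away_mk_pow]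
  -- move the second factor to the bookkeeping `X_one_mul_X_two_mem`, multiply, compare numerators
  have hFd : F ∈ homogeneousSubmodule (Fin 3) k (d • 1) := by
    rw [smul_eq_mul, mul_one]; exact (mem_homogeneousSubmodule d F).mpr hF
  have hmem1 : F * X 1 ^ d ∈ homogeneousSubmodule (Fin 3) k (d • 1 + d • 1) :=
    SetLike.mul_mem_graded hFd (SetLike.pow_mem_graded d (X_one_mem k))
  have hmem2 : F * X 1 ^ d ∈ homogeneousSubmodule (Fin 3) k (d • 2) := by
    rw [mem_homogeneousSubmodule, smul_eq_mul, mul_two]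
    simpa using hF.mul ((isHomogeneous_X k (1 : Fin 3)).pow d)
  have e2 : Away.mk (homogeneousSubmodule (Fin 3) k)
        ((mul_comm (X 1 : MvPolynomial (Fin 3) k) (X 2)) ▸ SetLike.mul_mem_graded (X_two_mem k) (X_one_mem k)) d (F * X 1 ^ d)
        (by rw [smul_add]; exact hmem1) =
      Away.mk _ (X_one_mul_X_two_mem k) d (F * X 1 ^ d) hmem2 :=
    away_mk_eq_mk _ _ _ _ _ rfl
  rw [e2, away_mk_mul]
  exact away_mk_eq_mk _ _ _ _ _ (by ring)

/-- In `(k[X]_{(X₁X₂)})₀`: the image of `F/X₁^d` is the fraction `F X₂^d/(X₁X₂)^d` of `planeCurve_twisted_split`. [folklore] -/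
theorem awayMap_chartEqn_one_eq_mk :
    awayMap (homogeneousSubmodule (Fin 3) k) (X_two_mem k) (rfl : (X 1 * X 2 : MvPolynomial (Fin 3) k) = X 1 * X 2)
        (SmoothHypersurface.chartEqn F 1 hF) =
      Away.mk _ (X_one_mul_X_two_mem k) d (F * X 2 ^ d) (mul_X_two_pow_mem hF) := by
  rw [chartEqn_eq_mk F hF 1, awayMap_mk]

/-- The restricted chart equation `(F/X₁^d)|` lies in the ideal of the curve over `D₊(X₁) ∩ D₊(X₂)`. [folklore] -/
theorem res_chartEqn_one_mem (hd : 0 < d) (hrad : (Ideal.span {SmoothHypersurface.chartEqn F 1 hF}).IsRadical)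
    (h01 : IsAffineOpen (((SmoothHypersurface.coordChartOpen (n := 1) k 1 : (Proj (homogeneousSubmodule (Fin 3) k)).Opens) ⊓
      (SmoothHypersurface.coordChartOpen (n := 1) k 2 : (Proj (homogeneousSubmodule (Fin 3) k)).Opens)))) :
    (Proj (homogeneousSubmodule (Fin 3) k)).presheaf.map (homOfLE (inf_le_left :
        ((SmoothHypersurface.coordChartOpen (n := 1) k 1 : (Proj (homogeneousSubmodule (Fin 3) k)).Opens) ⊓
          (SmoothHypersurface.coordChartOpen (n := 1) k 2 : (Proj (homogeneousSubmodule (Fin 3) k)).Opens)) ≤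
        (SmoothHypersurface.coordChartOpen (n := 1) k 1 : (Proj (homogeneousSubmodule (Fin 3) k)).Opens))).op
        ((Proj.awayToSection (homogeneousSubmodule (Fin 3) k) (X 1)).hom (SmoothHypersurface.chartEqn F 1 hF)) ∈
      (SmoothHypersurface.idealSheaf F).ideal ⟨_, h01⟩ := by
  have hmem : (Proj.awayToSection (homogeneousSubmodule (Fin 3) k) (X 1)).hom (SmoothHypersurface.chartEqn F 1 hF) ∈
      (SmoothHypersurface.idealSheaf F).ideal (SmoothHypersurface.coordChartOpen k 1) := by
    rw [← span_chartEqn_eq_ideal F hF hd 1 hrad]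
    exact Ideal.subset_span rfl
  have h := Scheme.IdealSheafData.ideal_le_comap_ideal (SmoothHypersurface.idealSheaf F) (U := ⟨_, h01⟩)
    (V := SmoothHypersurface.coordChartOpen (n := 1) k 1)
    (show ((SmoothHypersurface.coordChartOpen (n := 1) k 1 : (Proj (homogeneousSubmodule (Fin 3) k)).Opens) ⊓
        (SmoothHypersurface.coordChartOpen (n := 1) k 2 : (Proj (homogeneousSubmodule (Fin 3) k)).Opens)) ≤
      (SmoothHypersurface.coordChartOpen (n := 1) k 1 : (Proj (homogeneousSubmodule (Fin 3) k)).Opens) from inf_le_left) hmem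
  exact Ideal.mem_comap.1 h

/-- **The transition on sections**: `(F/X₁^d)| = M · (F/X₂^d)|` on `D₊(X₁) ∩ D₊(X₂)`, `M = ((X₂/X₁)^d)|`. [folklore] -/
theorem transition_sections :
    (Proj (homogeneousSubmodule (Fin 3) k)).presheaf.map (homOfLE (inf_le_left :
        ((SmoothHypersurface.coordChartOpen (n := 1) k 1 : (Proj (homogeneousSubmodule (Fin 3) k)).Opens) ⊓
          (SmoothHypersurface.coordChartOpen (n := 1) k 2 : (Proj (homogeneousSubmodule (Fin 3) k)).Opens)) ≤
        (SmoothHypersurface.coordChartOpen (n := 1) k 1 : (Proj (homogeneousSubmodule (Fin 3) k)).Opens))).op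
        ((Proj.awayToSection (homogeneousSubmodule (Fin 3) k) (X 1)).hom (SmoothHypersurface.chartEqn F 1 hF)) =
      ∑ _j : Fin 1, (Proj (homogeneousSubmodule (Fin 3) k)).presheaf.map (homOfLE (inf_chart_le k)).op
          ((Proj.awayToSection (homogeneousSubmodule (Fin 3) k) (X 1 * X 2)).hom
            (Away.mk _ (X_one_mul_X_two_mem k) 1 (X 2 * X 2) (X_two_sq_mem k) ^ d)) *
        (Proj (homogeneousSubmodule (Fin 3) k)).presheaf.map (homOfLE (inf_le_right :
          ((SmoothHypersurface.coordChartOpen (n := 1) k 1 : (Proj (homogeneousSubmodule (Fin 3) k)).Opens) ⊓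
            (SmoothHypersurface.coordChartOpen (n := 1) k 2 : (Proj (homogeneousSubmodule (Fin 3) k)).Opens)) ≤
          (SmoothHypersurface.coordChartOpen (n := 1) k 2 : (Proj (homogeneousSubmodule (Fin 3) k)).Opens))).op
          ((Proj.awayToSection (homogeneousSubmodule (Fin 3) k) (X 2)).hom (SmoothHypersurface.chartEqn F 2 hF)) := by
  let Ψ : Away (homogeneousSubmodule (Fin 3) k) (X 1 * X 2 : MvPolynomial (Fin 3) k) →+*
      Γ((Proj (homogeneousSubmodule (Fin 3) k)),
        ((SmoothHypersurface.coordChartOpen (n := 1) k 1 : (Proj (homogeneousSubmodule (Fin 3) k)).Opens) ⊓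
          (SmoothHypersurface.coordChartOpen (n := 1) k 2 : (Proj (homogeneousSubmodule (Fin 3) k)).Opens))) :=
    ((Proj (homogeneousSubmodule (Fin 3) k)).presheaf.map (homOfLE (inf_chart_le k)).op).hom.comp
      (Proj.awayToSection (homogeneousSubmodule (Fin 3) k) (X 1 * X 2)).hom
  have hΨ : ∀ z, Ψ z = (Proj (homogeneousSubmodule (Fin 3) k)).presheaf.map (homOfLE (inf_chart_le k)).op
      ((Proj.awayToSection (homogeneousSubmodule (Fin 3) k) (X 1 * X 2)).hom z) := fun z => rfl
  rw [Fin.sum_univ_one, res₁_awayToSection, res₂_awayToSection, ← hΨ, ← hΨ, ← hΨ, ← map_mul, awayMap_chartEqn_one_eq F hF]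

/-- **The twisted splitting on sections**: every `c ∈ Γ(D₊(X₁) ∩ D₊(X₂))` is `a| + M·b|` modulo the ideal of the curve (`a ∈ Γ(D₊(X₁))`,
`b ∈ Γ(D₊(X₂))`) — `planeCurve_twisted_split` transported along `(k[X]_{(X₁X₂)})₀ → Γ(D₊(X₁X₂)) → Γ(D₊(X₁) ∩ D₊(X₂))`. [OURS · L1 W4.5b] -/
theorem twisted_splitting_sections (hd : 0 < d) (hu : IsUnit (coeff (Finsupp.single 0 d) F))
    (hrad : (Ideal.span {SmoothHypersurface.chartEqn F 1 hF}).IsRadical)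
    (h01 : IsAffineOpen (((SmoothHypersurface.coordChartOpen (n := 1) k 1 : (Proj (homogeneousSubmodule (Fin 3) k)).Opens) ⊓
      (SmoothHypersurface.coordChartOpen (n := 1) k 2 : (Proj (homogeneousSubmodule (Fin 3) k)).Opens))))
    (c : Fin 1 → Γ((Proj (homogeneousSubmodule (Fin 3) k)),
      ((SmoothHypersurface.coordChartOpen (n := 1) k 1 : (Proj (homogeneousSubmodule (Fin 3) k)).Opens) ⊓
        (SmoothHypersurface.coordChartOpen (n := 1) k 2 : (Proj (homogeneousSubmodule (Fin 3) k)).Opens)))) :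
    ∃ (a : Fin 1 → Γ((Proj (homogeneousSubmodule (Fin 3) k)), (SmoothHypersurface.coordChartOpen (n := 1) k 1 : (Proj (homogeneousSubmodule (Fin 3) k)).Opens)))
      (b : Fin 1 → Γ((Proj (homogeneousSubmodule (Fin 3) k)), (SmoothHypersurface.coordChartOpen (n := 1) k 2 : (Proj (homogeneousSubmodule (Fin 3) k)).Opens))),
      ∀ κ, c κ - ((Proj (homogeneousSubmodule (Fin 3) k)).presheaf.map (homOfLE (inf_le_left :
          ((SmoothHypersurface.coordChartOpen (n := 1) k 1 : (Proj (homogeneousSubmodule (Fin 3) k)).Opens) ⊓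
            (SmoothHypersurface.coordChartOpen (n := 1) k 2 : (Proj (homogeneousSubmodule (Fin 3) k)).Opens)) ≤
          (SmoothHypersurface.coordChartOpen (n := 1) k 1 : (Proj (homogeneousSubmodule (Fin 3) k)).Opens))).op (a κ) +
        ∑ j, (Proj (homogeneousSubmodule (Fin 3) k)).presheaf.map (homOfLE (inf_chart_le k)).op
            ((Proj.awayToSection (homogeneousSubmodule (Fin 3) k) (X 1 * X 2)).hom
              (Away.mk _ (X_one_mul_X_two_mem k) 1 (X 2 * X 2) (X_two_sq_mem k) ^ d)) *
          (Proj (homogeneousSubmodule (Fin 3) k)).presheaf.map (homOfLE (inf_le_right :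
            ((SmoothHypersurface.coordChartOpen (n := 1) k 1 : (Proj (homogeneousSubmodule (Fin 3) k)).Opens) ⊓
              (SmoothHypersurface.coordChartOpen (n := 1) k 2 : (Proj (homogeneousSubmodule (Fin 3) k)).Opens)) ≤
            (SmoothHypersurface.coordChartOpen (n := 1) k 2 : (Proj (homogeneousSubmodule (Fin 3) k)).Opens))).op (b j)) ∈
        (SmoothHypersurface.idealSheaf F).ideal ⟨_, h01⟩ := by
  -- `Ψ : (k[X]_{(X₁X₂)})₀ → Γ(D₊(X₁) ∩ D₊(X₂))`
  let Ψ : Away (homogeneousSubmodule (Fin 3) k) (X 1 * X 2 : MvPolynomial (Fin 3) k) →+*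
      Γ((Proj (homogeneousSubmodule (Fin 3) k)),
        ((SmoothHypersurface.coordChartOpen (n := 1) k 1 : (Proj (homogeneousSubmodule (Fin 3) k)).Opens) ⊓
          (SmoothHypersurface.coordChartOpen (n := 1) k 2 : (Proj (homogeneousSubmodule (Fin 3) k)).Opens))) :=
    ((Proj (homogeneousSubmodule (Fin 3) k)).presheaf.map (homOfLE (inf_chart_le k)).op).hom.comp
      (Proj.awayToSection (homogeneousSubmodule (Fin 3) k) (X 1 * X 2)).hom
  have hΨ : ∀ z, Ψ z = (Proj (homogeneousSubmodule (Fin 3) k)).presheaf.map (homOfLE (inf_chart_le k)).op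
      ((Proj.awayToSection (homogeneousSubmodule (Fin 3) k) (X 1 * X 2)).hom z) := fun z => rfl
  obtain ⟨γ, hγ⟩ := surjective_res_awayToSection₁₂ k (c 0)
  have hγ' : Ψ γ = c 0 := hγ
  obtain ⟨v₁, v₂, w, hsplit⟩ := planeCurve_twisted_split (R := k) hF hu γ
  refine ⟨fun _ => (Proj.awayToSection (homogeneousSubmodule (Fin 3) k) (X 1)).hom v₁,
    fun _ => (Proj.awayToSection (homogeneousSubmodule (Fin 3) k) (X 2)).hom v₂, fun κ => ?_⟩
  obtain rfl : κ = 0 := Subsingleton.elim _ _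
  -- `Ψ (F X₂^d/(X₁X₂)^d) = (F/X₁^d)|` lies in the ideal, hence so does `Ψ (w · F X₂^d/(X₁X₂)^d)`
  have hfL : Ψ (w * Away.mk _ (X_one_mul_X_two_mem k) d (F * X 2 ^ d) (mul_X_two_pow_mem hF)) ∈
      (SmoothHypersurface.idealSheaf F).ideal ⟨_, h01⟩ := by
    rw [map_mul]
    refine Ideal.mul_mem_left _ _ ?_
    rw [← awayMap_chartEqn_one_eq_mk F hF, hΨ, ← res₁_awayToSection]
    exact res_chartEqn_one_mem F hF hd hrad h01
  have e_a : (Proj (homogeneousSubmodule (Fin 3) k)).presheaf.map (homOfLE (inf_le_left :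
        ((SmoothHypersurface.coordChartOpen (n := 1) k 1 : (Proj (homogeneousSubmodule (Fin 3) k)).Opens) ⊓
          (SmoothHypersurface.coordChartOpen (n := 1) k 2 : (Proj (homogeneousSubmodule (Fin 3) k)).Opens)) ≤
        (SmoothHypersurface.coordChartOpen (n := 1) k 1 : (Proj (homogeneousSubmodule (Fin 3) k)).Opens))).op
        ((Proj.awayToSection (homogeneousSubmodule (Fin 3) k) (X 1)).hom v₁) =
      Ψ (awayMap (homogeneousSubmodule (Fin 3) k) (X_two_mem k) (rfl : (X 1 * X 2 : MvPolynomial (Fin 3) k) = X 1 * X 2) v₁) :=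
    res₁_awayToSection k _
  have e_b : (Proj (homogeneousSubmodule (Fin 3) k)).presheaf.map (homOfLE (inf_le_right :
        ((SmoothHypersurface.coordChartOpen (n := 1) k 1 : (Proj (homogeneousSubmodule (Fin 3) k)).Opens) ⊓
          (SmoothHypersurface.coordChartOpen (n := 1) k 2 : (Proj (homogeneousSubmodule (Fin 3) k)).Opens)) ≤
        (SmoothHypersurface.coordChartOpen (n := 1) k 2 : (Proj (homogeneousSubmodule (Fin 3) k)).Opens))).op
        ((Proj.awayToSection (homogeneousSubmodule (Fin 3) k) (X 2)).hom v₂) =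
      Ψ (awayMap (homogeneousSubmodule (Fin 3) k) (X_one_mem k) (mul_comm (X 1 : MvPolynomial (Fin 3) k) (X 2)) v₂) :=
    res₂_awayToSection k _
  have e_M : (Proj (homogeneousSubmodule (Fin 3) k)).presheaf.map (homOfLE (inf_chart_le k)).op
        ((Proj.awayToSection (homogeneousSubmodule (Fin 3) k) (X 1 * X 2)).hom
          (Away.mk _ (X_one_mul_X_two_mem k) 1 (X 2 * X 2) (X_two_sq_mem k) ^ d)) =
      Ψ (Away.mk _ (X_one_mul_X_two_mem k) 1 (X 2 * X 2) (X_two_sq_mem k) ^ d) := rfl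
  have eG : c 0 - ((Proj (homogeneousSubmodule (Fin 3) k)).presheaf.map (homOfLE (inf_le_left :
          ((SmoothHypersurface.coordChartOpen (n := 1) k 1 : (Proj (homogeneousSubmodule (Fin 3) k)).Opens) ⊓
            (SmoothHypersurface.coordChartOpen (n := 1) k 2 : (Proj (homogeneousSubmodule (Fin 3) k)).Opens)) ≤
          (SmoothHypersurface.coordChartOpen (n := 1) k 1 : (Proj (homogeneousSubmodule (Fin 3) k)).Opens))).op
          ((Proj.awayToSection (homogeneousSubmodule (Fin 3) k) (X 1)).hom v₁) +
        ∑ _j : Fin 1, (Proj (homogeneousSubmodule (Fin 3) k)).presheaf.map (homOfLE (inf_chart_le k)).op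
            ((Proj.awayToSection (homogeneousSubmodule (Fin 3) k) (X 1 * X 2)).hom
              (Away.mk _ (X_one_mul_X_two_mem k) 1 (X 2 * X 2) (X_two_sq_mem k) ^ d)) *
          (Proj (homogeneousSubmodule (Fin 3) k)).presheaf.map (homOfLE (inf_le_right :
            ((SmoothHypersurface.coordChartOpen (n := 1) k 1 : (Proj (homogeneousSubmodule (Fin 3) k)).Opens) ⊓
              (SmoothHypersurface.coordChartOpen (n := 1) k 2 : (Proj (homogeneousSubmodule (Fin 3) k)).Opens)) ≤
            (SmoothHypersurface.coordChartOpen (n := 1) k 2 : (Proj (homogeneousSubmodule (Fin 3) k)).Opens))).op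
            ((Proj.awayToSection (homogeneousSubmodule (Fin 3) k) (X 2)).hom v₂)) =
      Ψ (γ - (awayMap (homogeneousSubmodule (Fin 3) k) (X_two_mem k) (rfl : (X 1 * X 2 : MvPolynomial (Fin 3) k) = X 1 * X 2) v₁ +
        Away.mk _ (X_one_mul_X_two_mem k) 1 (X 2 * X 2) (X_two_sq_mem k) ^ d *
          awayMap (homogeneousSubmodule (Fin 3) k) (X_one_mem k) (mul_comm (X 1 : MvPolynomial (Fin 3) k) (X 2)) v₂)) := by
    rw [Fin.sum_univ_one, e_a, e_b, e_M, ← hγ', map_sub, map_add, map_mul]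
  have hw : γ - (awayMap (homogeneousSubmodule (Fin 3) k) (X_two_mem k) (rfl : (X 1 * X 2 : MvPolynomial (Fin 3) k) = X 1 * X 2) v₁ +
        Away.mk _ (X_one_mul_X_two_mem k) 1 (X 2 * X 2) (X_two_sq_mem k) ^ d *
          awayMap (homogeneousSubmodule (Fin 3) k) (X_one_mem k) (mul_comm (X 1 : MvPolynomial (Fin 3) k) (X 2)) v₂) =
      w * Away.mk _ (X_one_mul_X_two_mem k) d (F * X 2 ^ d) (mul_X_two_pow_mem hF) := by
    rw [hsplit]; ring
  rw [eG, hw]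
  exact hfL

/-! ### The certificate -/

/-- **EVERY PLANE CURVE IS UNOBSTRUCTED (model level)** — `DirStepUnobs ℙ²_k univ _ V₊(F) _`: for a field `k`, a homogeneous
`F ∈ k[X₀,X₁,X₂]` of degree `d ≥ 1` with `X₀^d`-coefficient a unit (the point `(1:0:0)` is off the curve — over an infinite field a linear change
of coordinates arranges it) whose two chart equations `F/X₁^d`, `F/X₂^d` generate RADICAL ideals of the chart rings (i.e. `F` cuts the REDUCED
curve out on `D₊(X₁)`, `D₊(X₂)` — the case of a squarefree `F`), the embedded deformations of the reduced curve `V₊(F) ⊂ ℙ²_k` are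
unobstructed: `Ȟ¹(C, 𝒩_{C/ℙ²}) = Ȟ¹(C, 𝒪_C(d)) = 0` in the tree's Čech vocabulary.  Assembly of res-L1-w45b-nose-w1's producer ✓
`dirStepUnobs_univ_of_two_charts` (D3-7) with: charts `D₊(X₁)`, `D₊(X₂)`; generators `F/X₁^d`, `F/X₂^d` (quasi-regular, generating the
curve's ideal by the tree's `idealSheaf_ideal_coordChartOpen` + radicality); transition `M = (X₂/X₁)^d`; and the generic twisted splitting ✓
`planeCurve_twisted_split` (…NatPlaneCurveTwistedSplit).  With ✓ `dirStepUnobs_freshPlane_of_forall_model` (…NatFreshPlaneProj) this discharges the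
NEST clause `DirStepUnobs G' E' _ Z _` of every centre that is a reduced plane curve in a fresh plane `E' ≅ ℙ²` (S10's conic `d = 2`, lines
`d = 1`, the (β) post-carrier curves), given the model identification. [cite: Hartshorne1977, III Thm. 5.1] [OURS · L1 W4.5b · EL♮(3) · NEST
host kit part 3c; NOT a statement of the manuscript; counted 0] -/
theorem dirStepUnobs_planeCurve (hd : 0 < d) (hu : IsUnit (coeff (Finsupp.single 0 d) F))
    (hrad₁ : (Ideal.span {SmoothHypersurface.chartEqn F 1 hF}).IsRadical)
    (hrad₂ : (Ideal.span {SmoothHypersurface.chartEqn F 2 hF}).IsRadical) :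
    DirStepUnobs (Proj (homogeneousSubmodule (Fin 3) k)) Set.univ isClosed_univ
      (SmoothHypersurface.zeroLocusClosed F : Set _) (SmoothHypersurface.zeroLocusClosed F).isClosed := by
  -- `ℙ²_k` is integral (hence reduced) and locally Noetherian
  haveI : IsIntegral (Proj (homogeneousSubmodule (Fin 3) k)) := Literature.AlgebraicGeometry.Resolution.isIntegral_projectiveSpace 2 k
  haveI : IsLocallyNoetherian (Proj (homogeneousSubmodule (Fin 3) k)) :=
    LocallyOfFiniteType.isLocallyNoetherian (projectiveSpace 2 k).hom
  have hF0 : F ≠ 0 := by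
    rintro rfl
    rw [coeff_zero] at hu
    exact not_isUnit_zero hu
  have h01 := isAffineOpen_inf_chart k
  refine dirStepUnobs_univ_of_two_charts (Proj (homogeneousSubmodule (Fin 3) k)) _ _
    (SmoothHypersurface.coordChartOpen (n := 1) k 1) (SmoothHypersurface.coordChartOpen (n := 1) k 2) h01 ?_
    (fun _ : Fin 1 => (Proj.awayToSection (homogeneousSubmodule (Fin 3) k) (X 1)).hom (SmoothHypersurface.chartEqn F 1 hF))
    (fun _ : Fin 1 => (Proj.awayToSection (homogeneousSubmodule (Fin 3) k) (X 2)).hom (SmoothHypersurface.chartEqn F 2 hF))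
    (isQuasiRegular_chartEqn F hF hF0 1) (isQuasiRegular_chartEqn F hF hF0 2) ?_ ?_
    (fun _ _ => (Proj (homogeneousSubmodule (Fin 3) k)).presheaf.map (homOfLE (inf_chart_le k)).op
      ((Proj.awayToSection (homogeneousSubmodule (Fin 3) k) (X 1 * X 2)).hom
        (Away.mk _ (X_one_mul_X_two_mem k) 1 (X 2 * X 2) (X_two_sq_mem k) ^ d)))
    (fun _ => transition_sections F hF) (twisted_splitting_sections F hF hd hu hrad₁ h01)
  · -- `V₊(F) ⊆ D₊(X₁) ∪ D₊(X₂)`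
    intro p hp
    rw [SmoothHypersurface.coe_zeroLocusClosed, ProjectiveSpectrum.mem_zeroLocus, Set.singleton_subset_iff] at hp
    rcases X_one_notMem_or_X_two_notMem F hF hu p hp with h | h
    · exact Or.inl ((Proj.mem_basicOpen _ _ _).2 h)
    · exact Or.inr ((Proj.mem_basicOpen _ _ _).2 h)
  · rw [Set.range_const]; exact span_chartEqn_eq_ideal F hF hd 1 hrad₁
  · rw [Set.range_const]; exact span_chartEqn_eq_ideal F hF hd 2 hrad₂

end Curve

end PlaneCurveSplit

end Summit.ResolutionOfSingularities.ResolutionOfSingularities.Cruxes.EquisingularLiftNat.Sections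

end
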